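import Mathlib
import Literature.MathematicalPhysics.QuantumLattice.WilsonDiracAP

/-!
# Tiling form of the one-cell gain implies the gauged form
(helper for crux stmt-QuantumFields-9734, line `Sketch`, stub `stub_cellGainTilingGlue`)

Glue lemma `(CellGainTiling) → (CellGainGauged)` of the chessboard / cell-gain line.  The lead proves the
one-cell gain in TILING FORM: on the even torus `(ℤ/2M)⁴`, `M ≥ M₀`, for `|m| ≤ ε` and every cell `c`
whose `32` closed-cell links have deficit `≤ η`,
`‖det D_AP[tile_c V]‖ ≤ exp(K_g − c_g · M⁴ · S_cell) · ‖det D_AP[1]‖`, the free seam field being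
written `e ↦ if x_μ + 1 = 2M then (-1 : U(3)) else 1`.  The skeleton's composition consumes the GAUGED
FORM: for every even `L ≥ L₀`, `Re det_AP[tile_cell V] ≤ exp(K₀ − c · (L⁴/4) · S_cell) · ‖det_AP[1]‖`,
stated through the `let`s `dAP, tile, dfc, inCell`.  Proof: take the same `η, ε`, `K₀ := K_g`,
`c := c_g / 4`, `L₀ := 2 M₀`; write `L = 2M` (`Even L`, `subst`), so `L⁴/4 = 4 M⁴` and
`(c_g/4) · (L⁴/4) = c_g · M⁴`; `Re z ≤ ‖z‖` (`Complex.re_le_norm`); `dAP (tile cell V) m` and `dAP 1 m`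
unfold (zeta/beta, `Pi.one_apply` definitionally) to the tiling form's determinants; the two cell sums agree
up to the `Decidable` instance of the filter (`Subsingleton.elim`).  Pure theorem file (no definitions);
imports: Mathlib, the tree (`WilsonDiracAP`).
-/

noncomputable section

open scoped BigOperators Classical Matrix ComplexConjugate
open Finset
open Literature.MathematicalPhysics.QuantumLattice Literature.MathematicalPhysics.QuantumFieldTheory
  Literature.Probability.LatticeModels

namespace Summit.QuantumFields.QCD.Cruxes.CriticalLineDiamagnetism.ChessboardCellGain

namespace StubCellGainTilingGlueAux

/-- Filtering a Finset by the same predicate with two `Decidable` instances gives the same Finset. -/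
theorem filter_inst_congr {α : Type*} (P : α → Prop) (i₁ i₂ : DecidablePred P) (s : Finset α) :
    @Finset.filter α P i₁ s = @Finset.filter α P i₂ s := by
  rw [Subsingleton.elim i₁ i₂]

/-- The arithmetic/analytic core of the glue: from `‖A‖ ≤ exp(K − c_g M⁴ S) ‖B‖` and `S = S'` to
`Re A ≤ exp(K − (c_g/4) ((2M)⁴/4) S') ‖B‖`. -/
theorem glue_ineq {A B : ℂ} {Kg cg S S' : ℝ} {M : ℕ} (hS : S = S')
    (h : ‖A‖ ≤ Real.exp (Kg - cg * (M : ℝ) ^ 4 * S) * ‖B‖) :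
    A.re ≤ Real.exp (Kg - cg / 4 * (((2 * M : ℕ) : ℝ) ^ 4 / 4) * S') * ‖B‖ := by
  have hexp : cg / 4 * (((2 * M : ℕ) : ℝ) ^ 4 / 4) * S' = cg * (M : ℝ) ^ 4 * S := by
    rw [← hS]; push_cast; ring
  rw [hexp]
  exact (Complex.re_le_norm A).trans h

end StubCellGainTilingGlueAux

/-- **Stub 3g (tiling form ⇒ gauged form of the one-cell gain).**  If the one-cell gain holds on
`(ℤ/2M)⁴`, `M ≥ M₀`, as `‖det D_AP[tile_c V]‖ ≤ exp(K_g − c_g M⁴ S_cell) ‖det D_AP[1]‖` under the link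
hypothesis, then `CellGainGauged` holds with `c := c_g/4`, `K₀ := K_g`, `L₀ := 2M₀` (same `η, ε`):
`L = 2M`, `L⁴/4 = 4M⁴`, `Re z ≤ ‖z‖`, and the `let`s unfold to the tiling form. -/
theorem stub_cellGainTilingGlue : (∃ η cg Kg ε : ℝ, 0 < η ∧ 0 < cg ∧ 0 < ε ∧ ∃ M₀ : ℕ, ∀ (M : ℕ) [NeZero M], M₀ ≤ M → ∀ (m : ℝ), |m| ≤ ε → ∀ (V : GaugeConfig 4 (2 * M) (Matrix.unitaryGroup (Fin 3) ℂ)) (c : Site 4 (2 * M)), (∀ e : Edge 4 (2 * M), ((∀ ν, (e.1 ν - c ν).val ≤ 1) ∧ (e.1 e.2 - c e.2).val = 0) → 3 - ((V e : Matrix.unitaryGroup (Fin 3) ℂ) : Matrix (Fin 3) (Fin 3) ℂ).trace.re ≤ η) → let tile : Site 4 (2 * M) → GaugeConfig 4 (2 * M) (Matrix.unitaryGroup (Fin 3) ℂ) → GaugeConfig 4 (2 * M) (Matrix.unitaryGroup (Fin 3) ℂ) := fun c V e => if (e.1 e.2 - c e.2).val % 2 = 0 then V (fun ν => c ν + (((e.1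 ν - c ν).val % 2 : ℕ) : ZMod (2 * M)), e.2) else (V (fun ν => c ν + (((Site.shift e.1 e.2 ν - c ν).val % 2 : ℕ) : ZMod (2 * M)), e.2))⁻¹; ‖(wilsonDirac (unitaryFundamentalRep (Fin 3) ℂ) (fun e => if (e.1 e.2).val + 1 = 2 * M then -(tile c V e) else tile c V e) m 1).det‖ ≤ Real.exp (Kg - cg * (M : ℝ) ^ 4 * ∑ p ∈ univ.filter (fun p : Plaquette 4 (2 * M) => p.1 p.2.1.1 = c p.2.1.1 ∧ p.1 p.2.1.2 = c p.2.1.2 ∧ ∀ ν, ν ≠ p.2.1.1 → ν ≠ p.2.1.2 → (p.1 ν = c ν ∨ p.1 ν = c ν + 1)), (3 - (unitaryFundamentalRep (Fin 3) ℂ (plaquetteHolonomy V p.1 p.2.1.1 p.2.1.2)).trace.re)) * ‖(wilsonDirac (unitaryFundamentalRep (Fin 3) ℂ) (fun e : Edge 4 (2 * M) => if (e.1 e.2).val + 1 = 2 * M then (-1 : Matrix.unitaryGroup (Fin 3) ℂ) else 1) m 1).det‖) → (∃ η c K₀ ε : ℝ, 0 < η ∧ 0 < c ∧ 0 < ε ∧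 ∃ L₀ : ℕ, ∀ (L : ℕ) [NeZero L], Even L → L₀ ≤ L → let dAP : GaugeConfig 4 L (Matrix.unitaryGroup (Fin 3) ℂ) → ℝ → ℂ := fun V m => (wilsonDirac (unitaryFundamentalRep (Fin 3) ℂ) (fun e => if (e.1 e.2).val + 1 = L then -V e else V e) m 1).det; let tile : Site 4 L → GaugeConfig 4 L (Matrix.unitaryGroup (Fin 3) ℂ) → GaugeConfig 4 L (Matrix.unitaryGroup (Fin 3) ℂ) := fun c V e => if (e.1 e.2 - c e.2).val % 2 = 0 then V (fun ν => c ν + (((e.1 ν - c ν).val % 2 : ℕ) : ZMod L), e.2) else (V (fun ν => c ν + (((Site.shift e.1 e.2 ν - c ν).val % 2 : ℕ) : ZMod L), e.2))⁻¹; let dfc : GaugeConfig 4 L (Matrix.unitaryGroup (Fin 3) ℂ) → Plaquette 4 L → ℝ := fun V p => 3 - (unitaryFundamentalRep (Fin 3) ℂ (plaquetteHolonomy V p.1 p.2.1.1 p.2.1.2)).trace.re; let inCell : Site 4 L → Plaquette 4 L → Prop := fun c p => p.1 p.2.1.1 = c p.2.1.1 ∧ p.1 p.2.1.2 = c p.2.1.2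 ∧ ∀ ν, ν ≠ p.2.1.1 → ν ≠ p.2.1.2 → (p.1 ν = c ν ∨ p.1 ν = c ν + 1); ∀ (V : GaugeConfig 4 L (Matrix.unitaryGroup (Fin 3) ℂ)) (cell : Site 4 L) (m : ℝ), |m| ≤ ε → (∀ e : Edge 4 L, ((∀ ν, (e.1 ν - cell ν).val ≤ 1) ∧ (e.1 e.2 - cell e.2).val = 0) → 3 - ((V e : Matrix.unitaryGroup (Fin 3) ℂ) : Matrix (Fin 3) (Fin 3) ℂ).trace.re ≤ η) → (dAP (tile cell V) m).re ≤ Real.exp (K₀ - c * ((L : ℝ) ^ 4 / 4) * ∑ p ∈ univ.filter (fun p => inCell cell p), dfc V p) * ‖dAP 1 m‖) := by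
  rintro ⟨η, cg, Kg, ε, hη, hcg, hε, M₀, h⟩
  refine ⟨η, cg / 4, Kg, ε, hη, by positivity, hε, 2 * M₀, ?_⟩
  intro L _ hEven hL
  obtain ⟨M, hM⟩ := hEven
  obtain rfl : L = 2 * M := by omega
  have hM₀ : M₀ ≤ M := by omega
  haveI : NeZero M := ⟨by rintro rfl; exact NeZero.ne (2 * 0) rfl⟩
  intro dAP tile dfc inCell V cell m hm hlinks
  refine StubCellGainTilingGlueAux.glue_ineq ?_ (h M hM₀ m hm V cell hlinks)
  exact Finset.sum_congr (StubCellGainTilingGlueAux.filter_inst_congr _ _ _ _) (fun _ _ => rfl)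

end Summit.QuantumFields.QCD.Cruxes.CriticalLineDiamagnetism.ChessboardCellGain

end
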